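import Mathlib
import HarnessLib

/-!
# LatticeQCDFlow / Scaling — Le Cam on the PAIR laws on a GENERAL space:
# `(1 − acc)² + BC⁴ ≤ 1`, i.e. `acc(p, q) ≥ 1 − √(1 − (∫√(pq))⁴)`

HONEST FRAMING: exact (Metropolis-corrected) sampling algorithms for lattice gauge theory;
figures of merit are autocorrelation/cost numbers at stated couplings and volumes; no
continuum-physics claim.

Venture `LatticeQCDFlow` (cell pub-lqcd), topic `Scaling`; FANOUT row 3 (`s0-u1-a`, S0-B
implementation A, GEN-12).  NEW WORK of the cell (elementary), the measure-theoretic form of row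
3's finite `Scaling/AcceptanceBhattacharyyaFloor` (GEN-11: `(1 − acc)² + BC⁴ ≤ 1` on finite
configuration spaces, from row 31's Le Cam `BC² ≤ 1 − TV²` applied to the pair laws).  SETTING: a
measure `μ` on any measurable space (s-finite), densities `p, q ≥ 0` measurable integrable with
`∫ p = ∫ q = 1`; the pair densities `F(x,y) = p(x)q(y)`, `G(x,y) = p(y)q(x)` on `X × X`; the
acceptance `acc = ∫∫ min(p(x)q(y), p(y)q(x))` and the affinity `BC = ∫ √(pq)`.  NO definition.

* `integral_pairMin_eq_prod`, `integral_abs_pair_sub_eq` — `acc = ∫ min(F, G) d(μ⊗μ)` and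
  `∫ |F − G| d(μ⊗μ) = 2(1 − acc)`;
* `integral_sqrt_pair_mul_eq` — `∫ √(F G) d(μ⊗μ) = BC²`;
* `two_mul_one_sub_meanAccept_le` — for every `t > 0`:
  `2(1 − acc) ≤ t·(1 − BC²) + (1 + BC²)/t` (`|F − G| = |√F − √G|(√F + √G)` and `2ab ≤ ta² + b²/t`);
* `sq_add_sq_le_one_of_forall_param` (the real-variable core, optimal `t`),
  **`sq_one_sub_meanAccept_add_pow_four_le_one`** — `(1 − acc)² + BC⁴ ≤ 1`, and
  **`one_sub_sqrt_le_meanAccept`** — `1 − √(1 − BC⁴) ≤ acc`: with `Scaling/AcceptanceVolumeDecayPi`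
  (`acc ≤ BC²`) the acceptance of ANY flow on ANY space lies in `[1 − √(1 − BC⁴), BC²]`.

Reading (value-free): for the factorised untrained baselines of `Scaling/U1IdentityFlowVolumeLaw`
(`BC₁² = I₀(β/2)²/I₀(β)`) this floor reads `acc_V ≥ 1 − √(1 − (I₀(β/2)²/I₀(β))^{2V})`, which
dominates `(8/9)·ESS_V` while `V·β²` is small and is dominated by it at large `V·β`.  NOT CLAIMED:
any acceptance value of ours; nothing re-scored.
-/

namespace Summit.Ventures.LatticeQCDFlow.Theory2

open MeasureTheory Set Filter

variable {X : Type*} [MeasurableSpace X] {μ : Measure X} [SFinite μ]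

/-- Bookkeeping for the pair densities `F = p ⊗ q`, `G = swap`: nonnegativity, measurability,
integrability and unit mass on `μ ⊗ μ`. [folklore] -/
theorem pairDensity_facts {p q : X → ℝ} (hp0 : ∀ x, 0 ≤ p x) (hpm : Measurable p)
    (hpi : Integrable p μ) (hp1 : ∫ x, p x ∂μ = 1) (hq0 : ∀ x, 0 ≤ q x) (hqm : Measurable q)
    (hqi : Integrable q μ) (hq1 : ∫ x, q x ∂μ = 1) :
    (∀ z : X × X, 0 ≤ p z.1 * q z.2) ∧ (∀ z : X × X, 0 ≤ p z.2 * q z.1) ∧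
    Measurable (fun z : X × X => p z.1 * q z.2) ∧ Measurable (fun z : X × X => p z.2 * q z.1) ∧
    Integrable (fun z : X × X => p z.1 * q z.2) (μ.prod μ) ∧
    Integrable (fun z : X × X => p z.2 * q z.1) (μ.prod μ) ∧
    ∫ z, p z.1 * q z.2 ∂(μ.prod μ) = 1 ∧ ∫ z, p z.2 * q z.1 ∂(μ.prod μ) = 1 := by
  have hGi : Integrable (fun z : X × X => p z.2 * q z.1) (μ.prod μ) := by
    have h := hqi.mul_prod hpi
    exact h.congr (Eventually.of_forall fun z => mul_comm _ _)
  refine ⟨fun z => mul_nonneg (hp0 _) (hq0 _), fun z => mul_nonneg (hp0 _) (hq0 _),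
    (hpm.comp measurable_fst).mul (hqm.comp measurable_snd),
    (hpm.comp measurable_snd).mul (hqm.comp measurable_fst), hpi.mul_prod hqi, hGi, ?_, ?_⟩
  · rw [integral_prod_mul, hp1, hq1, mul_one]
  · have e : ∀ z : X × X, p z.2 * q z.1 = q z.1 * p z.2 := fun z => mul_comm _ _
    simp_rw [e]
    rw [integral_prod_mul, hp1, hq1, mul_one]

/-- **`acc` as an integral over the product measure**: `∫∫ min(p(x)q(y), p(y)q(x)) dμ dμ =
∫ min(F, G) d(μ⊗μ)`. [folklore] -/
theorem integral_pairMin_eq_prod {p q : X → ℝ} (hp0 : ∀ x, 0 ≤ p x) (hpm : Measurable p)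
    (hpi : Integrable p μ) (hp1 : ∫ x, p x ∂μ = 1) (hq0 : ∀ x, 0 ≤ q x) (hqm : Measurable q)
    (hqi : Integrable q μ) (hq1 : ∫ x, q x ∂μ = 1) :
    ∫ x, ∫ y, min (p x * q y) (p y * q x) ∂μ ∂μ
      = ∫ z, min (p z.1 * q z.2) (p z.2 * q z.1) ∂(μ.prod μ) := by
  obtain ⟨hF0, hG0, hFm, hGm, hFi, -, -, -⟩ := pairDensity_facts hp0 hpm hpi hp1 hq0 hqm hqi hq1
  have hMi : Integrable (fun z : X × X => min (p z.1 * q z.2) (p z.2 * q z.1)) (μ.prod μ) := by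
    refine Integrable.mono' hFi (hFm.min hGm).aestronglyMeasurable (Eventually.of_forall fun z => ?_)
    rw [Real.norm_of_nonneg (le_min (hF0 z) (hG0 z))]
    exact min_le_left _ _
  rw [integral_prod _ hMi]

/-- **`∫ |F − G| d(μ⊗μ) = 2(1 − acc)`**. [folklore] -/
theorem integral_abs_pair_sub_eq {p q : X → ℝ} (hp0 : ∀ x, 0 ≤ p x) (hpm : Measurable p)
    (hpi : Integrable p μ) (hp1 : ∫ x, p x ∂μ = 1) (hq0 : ∀ x, 0 ≤ q x) (hqm : Measurable q)
    (hqi : Integrable q μ) (hq1 : ∫ x, q x ∂μ = 1) :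
    ∫ z, |p z.1 * q z.2 - p z.2 * q z.1| ∂(μ.prod μ)
      = 2 * (1 - ∫ x, ∫ y, min (p x * q y) (p y * q x) ∂μ ∂μ) := by
  obtain ⟨hF0, hG0, hFm, hGm, hFi, hGi, hF1, hG1⟩ := pairDensity_facts hp0 hpm hpi hp1 hq0 hqm hqi hq1
  have hMi : Integrable (fun z : X × X => min (p z.1 * q z.2) (p z.2 * q z.1)) (μ.prod μ) := by
    refine Integrable.mono' hFi (hFm.min hGm).aestronglyMeasurable (Eventually.of_forall fun z => ?_)
    rw [Real.norm_of_nonneg (le_min (hF0 z) (hG0 z))]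
    exact min_le_left _ _
  have e : ∀ z : X × X, |p z.1 * q z.2 - p z.2 * q z.1|
      = p z.1 * q z.2 + p z.2 * q z.1 - 2 * min (p z.1 * q z.2) (p z.2 * q z.1) := by
    intro z
    rcases le_total (p z.1 * q z.2) (p z.2 * q z.1) with h | h
    · rw [min_eq_left h, abs_of_nonpos (by linarith)]; ring
    · rw [min_eq_right h, abs_of_nonneg (by linarith)]; ring
  simp_rw [e]
  have hFG : Integrable (fun z : X × X => p z.1 * q z.2 + p z.2 * q z.1) (μ.prod μ) := hFi.add hGi
  have h2M : Integrable (fun z : X × X => 2 * min (p z.1 * q z.2) (p z.2 * q z.1)) (μ.prod μ) :=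
    hMi.const_mul 2
  rw [integral_sub hFG h2M, integral_add hFi hGi, integral_const_mul, hF1, hG1,
    integral_pairMin_eq_prod hp0 hpm hpi hp1 hq0 hqm hqi hq1]
  ring

/-- **`∫ √(F G) d(μ⊗μ) = BC²`**: `√(p(x)q(y)p(y)q(x)) = √(p(x)q(x))·√(p(y)q(y))`. [folklore] -/
theorem integral_sqrt_pair_mul_eq {p q : X → ℝ} (hp0 : ∀ x, 0 ≤ p x) (hq0 : ∀ x, 0 ≤ q x) :
    ∫ z, Real.sqrt (p z.1 * q z.2 * (p z.2 * q z.1)) ∂(μ.prod μ)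
      = (∫ x, Real.sqrt (p x * q x) ∂μ) ^ 2 := by
  have e : ∀ z : X × X, Real.sqrt (p z.1 * q z.2 * (p z.2 * q z.1))
      = Real.sqrt (p z.1 * q z.1) * Real.sqrt (p z.2 * q z.2) := by
    intro z
    rw [← Real.sqrt_mul (mul_nonneg (hp0 _) (hq0 _))]
    ring_nf
  simp_rw [e]
  rw [integral_prod_mul (μ := μ) (ν := μ) (fun x => Real.sqrt (p x * q x))
    (fun y => Real.sqrt (p y * q y)), sq]

/-- **The one-parameter Le Cam bound**: for every `t > 0`,
`2(1 − acc) ≤ t·(1 − BC²) + (1 + BC²)/t`. (Pointwise `|F − G| = |√F − √G|·(√F + √G) ≤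
(t(√F − √G)² + (√F + √G)²/t)/2`, and `∫(√F ∓ √G)² = 2 ∓ 2BC²`.) [ours] -/
theorem two_mul_one_sub_meanAccept_le {p q : X → ℝ} (hp0 : ∀ x, 0 ≤ p x) (hpm : Measurable p)
    (hpi : Integrable p μ) (hp1 : ∫ x, p x ∂μ = 1) (hq0 : ∀ x, 0 ≤ q x) (hqm : Measurable q)
    (hqi : Integrable q μ) (hq1 : ∫ x, q x ∂μ = 1) {t : ℝ} (ht : 0 < t) :
    2 * (1 - ∫ x, ∫ y, min (p x * q y) (p y * q x) ∂μ ∂μ)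
      ≤ t * (1 - (∫ x, Real.sqrt (p x * q x) ∂μ) ^ 2)
        + (1 + (∫ x, Real.sqrt (p x * q x) ∂μ) ^ 2) / t := by
  obtain ⟨hF0, hG0, hFm, hGm, hFi, hGi, hF1, hG1⟩ := pairDensity_facts hp0 hpm hpi hp1 hq0 hqm hqi hq1
  rw [← integral_abs_pair_sub_eq hp0 hpm hpi hp1 hq0 hqm hqi hq1,
    ← integral_sqrt_pair_mul_eq (μ := μ) hp0 hq0]
  -- the geometric mean of the pair densities is integrable (AM–GM)
  have hSm : Measurable (fun z : X × X => Real.sqrt (p z.1 * q z.2 * (p z.2 * q z.1))) :=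
    (hFm.mul hGm).sqrt
  have hSi : Integrable (fun z : X × X => Real.sqrt (p z.1 * q z.2 * (p z.2 * q z.1))) (μ.prod μ) := by
    refine Integrable.mono' (hFi.add hGi) hSm.aestronglyMeasurable (Eventually.of_forall fun z => ?_)
    rw [Real.norm_of_nonneg (Real.sqrt_nonneg _)]
    have h : p z.1 * q z.2 * (p z.2 * q z.1) ≤ (p z.1 * q z.2 + p z.2 * q z.1) ^ 2 := by
      nlinarith [hF0 z, hG0 z, sq_nonneg (p z.1 * q z.2 - p z.2 * q z.1)]
    calc Real.sqrt (p z.1 * q z.2 * (p z.2 * q z.1))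
        ≤ Real.sqrt ((p z.1 * q z.2 + p z.2 * q z.1) ^ 2) := Real.sqrt_le_sqrt h
      _ = p z.1 * q z.2 + p z.2 * q z.1 := Real.sqrt_sq (add_nonneg (hF0 z) (hG0 z))
  -- pointwise bound: `|F − G| ≤ (t/2)(F + G − 2√(FG)) + (F + G + 2√(FG))/(2t)`
  have hpt : ∀ z : X × X, |p z.1 * q z.2 - p z.2 * q z.1|
      ≤ t / 2 * (p z.1 * q z.2 + p z.2 * q z.1 - 2 * Real.sqrt (p z.1 * q z.2 * (p z.2 * q z.1)))
        + (p z.1 * q z.2 + p z.2 * q z.1 + 2 * Real.sqrt (p z.1 * q z.2 * (p z.2 * q z.1))) / (2 * t) := by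
    intro z
    set a := Real.sqrt (p z.1 * q z.2) with ha
    set b := Real.sqrt (p z.2 * q z.1) with hb
    have ha0 : 0 ≤ a := Real.sqrt_nonneg _
    have hb0 : 0 ≤ b := Real.sqrt_nonneg _
    have hF : p z.1 * q z.2 = a ^ 2 := (Real.sq_sqrt (hF0 z)).symm
    have hG : p z.2 * q z.1 = b ^ 2 := (Real.sq_sqrt (hG0 z)).symm
    have hS : Real.sqrt (p z.1 * q z.2 * (p z.2 * q z.1)) = a * b := by
      rw [Real.sqrt_mul (hF0 z)]
    rw [hS, hF, hG]
    have e1 : a ^ 2 - b ^ 2 = (a - b) * (a + b) := by ring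
    rw [e1, abs_mul, abs_of_nonneg (add_nonneg ha0 hb0)]
    -- `|a − b|(a + b) ≤ (t/2)(a − b)² + (a + b)²/(2t)`
    have key : |a - b| * (a + b) ≤ t / 2 * (a - b) ^ 2 + (a + b) ^ 2 / (2 * t) := by
      have h2 : 0 ≤ (t * |a - b| - (a + b)) ^ 2 := sq_nonneg _
      have h3 : |a - b| ^ 2 = (a - b) ^ 2 := sq_abs _
      have h4 : t / 2 * (a - b) ^ 2 + (a + b) ^ 2 / (2 * t) - |a - b| * (a + b)
          = (t * |a - b| - (a + b)) ^ 2 / (2 * t) := by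
        field_simp
        rw [← h3]
        ring
      have h5 : 0 ≤ (t * |a - b| - (a + b)) ^ 2 / (2 * t) := by positivity
      linarith
    calc |a - b| * (a + b) ≤ t / 2 * (a - b) ^ 2 + (a + b) ^ 2 / (2 * t) := key
      _ = t / 2 * (a ^ 2 + b ^ 2 - 2 * (a * b)) + (a ^ 2 + b ^ 2 + 2 * (a * b)) / (2 * t) := by ring
  have hAi : Integrable (fun z : X × X => |p z.1 * q z.2 - p z.2 * q z.1|) (μ.prod μ) :=
    (hFi.sub hGi).abs
  have hFG : Integrable (fun z : X × X => p z.1 * q z.2 + p z.2 * q z.1) (μ.prod μ) := hFi.add hGi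
  have h2S : Integrable (fun z : X × X => 2 * Real.sqrt (p z.1 * q z.2 * (p z.2 * q z.1)))
      (μ.prod μ) := hSi.const_mul 2
  have hR1 : Integrable (fun z : X × X =>
      p z.1 * q z.2 + p z.2 * q z.1 - 2 * Real.sqrt (p z.1 * q z.2 * (p z.2 * q z.1))) (μ.prod μ) :=
    hFG.sub h2S
  have hR2 : Integrable (fun z : X × X =>
      p z.1 * q z.2 + p z.2 * q z.1 + 2 * Real.sqrt (p z.1 * q z.2 * (p z.2 * q z.1))) (μ.prod μ) :=
    hFG.add h2S
  have hRi := (hR1.const_mul (t / 2)).add (hR2.div_const (2 * t))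
  calc ∫ z, |p z.1 * q z.2 - p z.2 * q z.1| ∂(μ.prod μ)
      ≤ ∫ z, (t / 2 * (p z.1 * q z.2 + p z.2 * q z.1 - 2 * Real.sqrt (p z.1 * q z.2 * (p z.2 * q z.1)))
          + (p z.1 * q z.2 + p z.2 * q z.1 + 2 * Real.sqrt (p z.1 * q z.2 * (p z.2 * q z.1)))
            / (2 * t)) ∂(μ.prod μ) := integral_mono hAi hRi hpt
    _ = t / 2 * (1 + 1 - 2 * ∫ z, Real.sqrt (p z.1 * q z.2 * (p z.2 * q z.1)) ∂(μ.prod μ))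
        + (1 + 1 + 2 * ∫ z, Real.sqrt (p z.1 * q z.2 * (p z.2 * q z.1)) ∂(μ.prod μ)) / (2 * t) := by
        rw [integral_add (hR1.const_mul _) (hR2.div_const _), integral_const_mul, integral_div,
          integral_sub hFG h2S, integral_add hFG h2S, integral_add hFi hGi, integral_const_mul,
          hF1, hG1]
    _ = _ := by
        field_simp
        ring

/-- **The real-variable core of Le Cam's bound**: if `A ≤ 1`, `0 ≤ B` and
`2(1 − A) ≤ t(1 − B) + (1 + B)/t` for every `t > 0`, then `(1 − A)² + B² ≤ 1`. [folklore] -/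
theorem sq_add_sq_le_one_of_forall_param {A B : ℝ} (hA1 : A ≤ 1) (hB0 : 0 ≤ B)
    (hle : ∀ t : ℝ, 0 < t → 2 * (1 - A) ≤ t * (1 - B) + (1 + B) / t) :
    (1 - A) ^ 2 + B ^ 2 ≤ 1 := by
  -- `B ≤ 1`: otherwise the right side is negative for a suitable `t`
  have hB1 : B ≤ 1 := by
    by_contra hB1
    rw [not_le] at hB1
    have h3B : 0 < 3 + B := by linarith
    have hB1' : B - 1 ≠ 0 := by linarith
    have ht : 0 < (3 + B) / (B - 1) := div_pos h3B (by linarith)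
    have h := hle _ ht
    have e : (3 + B) / (B - 1) * (1 - B) = -(3 + B) := by
      field_simp
      ring
    have e2 : (1 + B) / ((3 + B) / (B - 1)) = (1 + B) * (B - 1) / (3 + B) := by
      field_simp
    rw [e, e2] at h
    have h4 : (1 + B) * (B - 1) / (3 + B) < 3 + B := by
      rw [div_lt_iff₀ h3B]
      nlinarith
    linarith
  rcases hB1.lt_or_eq with hBlt | hBeq
  · -- optimal `t = √((1 + B)/(1 − B))`
    have h1B : 0 < 1 - B := by linarith
    set t : ℝ := Real.sqrt ((1 + B) / (1 - B)) with htdef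
    have ht : 0 < t := Real.sqrt_pos.2 (div_pos (by linarith) h1B)
    have ht2 : t ^ 2 = (1 + B) / (1 - B) := Real.sq_sqrt (div_pos (by linarith) h1B).le
    have ht3 : t ^ 2 * (1 - B) = 1 + B := by
      rw [ht2]
      field_simp
    have h := hle t ht
    have e1 : (1 + B) / t = t * (1 - B) := by
      rw [div_eq_iff ht.ne']
      linear_combination (-1 : ℝ) * ht3
    rw [e1] at h
    have h2 : 1 - A ≤ t * (1 - B) := by linarith
    have h0 : 0 ≤ 1 - A := by linarith
    have h3 : (1 - A) ^ 2 ≤ (t * (1 - B)) ^ 2 := by gcongr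
    have e3 : (t * (1 - B)) ^ 2 = 1 - B ^ 2 := by
      calc (t * (1 - B)) ^ 2 = t ^ 2 * (1 - B) * (1 - B) := by ring
        _ = (1 + B) * (1 - B) := by rw [ht3]
        _ = 1 - B ^ 2 := by ring
    rw [e3] at h3
    linarith
  · -- `B = 1`: then `2(1 − A) ≤ 2/t` for all `t > 0`, so `A = 1`
    have hA' : 1 - A ≤ 0 := by
      by_contra hpos
      rw [not_le] at hpos
      have ht : 0 < 2 / (1 - A) := div_pos two_pos hpos
      have h := hle _ ht
      rw [hBeq, sub_self, mul_zero, zero_add] at h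
      have e : (1 + 1) / (2 / (1 - A)) = 1 - A := by
        field_simp
        ring
      rw [e] at h
      linarith
    have hAeq : A = 1 := le_antisymm hA1 (by linarith)
    rw [hAeq, hBeq]
    norm_num

/-- **LE CAM ON THE PAIR LAWS (general space)**: `(1 − acc)² + BC⁴ ≤ 1` for every pair of
normalised nonnegative densities on any measure space, `BC = ∫ √(pq)`. [ours] -/
theorem sq_one_sub_meanAccept_add_pow_four_le_one {p q : X → ℝ} (hp0 : ∀ x, 0 ≤ p x)
    (hpm : Measurable p) (hpi : Integrable p μ) (hp1 : ∫ x, p x ∂μ = 1) (hq0 : ∀ x, 0 ≤ q x)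
    (hqm : Measurable q) (hqi : Integrable q μ) (hq1 : ∫ x, q x ∂μ = 1) :
    (1 - ∫ x, ∫ y, min (p x * q y) (p y * q x) ∂μ ∂μ) ^ 2
        + (∫ x, Real.sqrt (p x * q x) ∂μ) ^ 4 ≤ 1 := by
  have hA1 : ∫ x, ∫ y, min (p x * q y) (p y * q x) ∂μ ∂μ ≤ 1 := by
    obtain ⟨hF0, hG0, -, -, hFi, -, hF1, -⟩ := pairDensity_facts hp0 hpm hpi hp1 hq0 hqm hqi hq1
    rw [integral_pairMin_eq_prod hp0 hpm hpi hp1 hq0 hqm hqi hq1, ← hF1]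
    exact integral_mono_of_nonneg (Eventually.of_forall fun z => le_min (hF0 z) (hG0 z)) hFi
      (Eventually.of_forall fun z => min_le_left _ _)
  have h := sq_add_sq_le_one_of_forall_param hA1 (sq_nonneg (∫ x, Real.sqrt (p x * q x) ∂μ))
    fun t ht => two_mul_one_sub_meanAccept_le hp0 hpm hpi hp1 hq0 hqm hqi hq1 ht
  calc (1 - ∫ x, ∫ y, min (p x * q y) (p y * q x) ∂μ ∂μ) ^ 2 + (∫ x, Real.sqrt (p x * q x) ∂μ) ^ 4
      = (1 - ∫ x, ∫ y, min (p x * q y) (p y * q x) ∂μ ∂μ) ^ 2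
        + ((∫ x, Real.sqrt (p x * q x) ∂μ) ^ 2) ^ 2 := by ring
    _ ≤ 1 := h

/-- **`acc ≥ 1 − √(1 − BC⁴)`** on a general space — with `acc ≤ BC²`
(`Scaling/AcceptanceVolumeDecayPi.meanAccept_le_sq_integral_sqrt`) the acceptance of any flow
lies in `[1 − √(1 − BC⁴), BC²]`. [ours] -/
theorem one_sub_sqrt_le_meanAccept {p q : X → ℝ} (hp0 : ∀ x, 0 ≤ p x) (hpm : Measurable p)
    (hpi : Integrable p μ) (hp1 : ∫ x, p x ∂μ = 1) (hq0 : ∀ x, 0 ≤ q x) (hqm : Measurable q)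
    (hqi : Integrable q μ) (hq1 : ∫ x, q x ∂μ = 1) :
    1 - Real.sqrt (1 - (∫ x, Real.sqrt (p x * q x) ∂μ) ^ 4)
      ≤ ∫ x, ∫ y, min (p x * q y) (p y * q x) ∂μ ∂μ := by
  have h := sq_one_sub_meanAccept_add_pow_four_le_one hp0 hpm hpi hp1 hq0 hqm hqi hq1
  have h1 : (1 - ∫ x, ∫ y, min (p x * q y) (p y * q x) ∂μ ∂μ) ^ 2
      ≤ 1 - (∫ x, Real.sqrt (p x * q x) ∂μ) ^ 4 := by linarith
  have h2 : 1 - ∫ x, ∫ y, min (p x * q y) (p y * q x) ∂μ ∂μ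
      ≤ Real.sqrt (1 - (∫ x, Real.sqrt (p x * q x) ∂μ) ^ 4) := by
    calc 1 - ∫ x, ∫ y, min (p x * q y) (p y * q x) ∂μ ∂μ
        ≤ |1 - ∫ x, ∫ y, min (p x * q y) (p y * q x) ∂μ ∂μ| := le_abs_self _
      _ = Real.sqrt ((1 - ∫ x, ∫ y, min (p x * q y) (p y * q x) ∂μ ∂μ) ^ 2) :=
          (Real.sqrt_sq_eq_abs _).symm
      _ ≤ Real.sqrt (1 - (∫ x, Real.sqrt (p x * q x) ∂μ) ^ 4) := Real.sqrt_le_sqrt h1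
  linarith

end Summit.Ventures.LatticeQCDFlow.Theory2
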